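import Summits.BirchSwinnertonDyer.BirchSwinnertonDyer.Theorems.ResidualThetaTransportAtTwoThetaLayerLambdaCongruenceAtTwoOneLayerCrux
import Summits.BirchSwinnertonDyer.BirchSwinnertonDyer.Theorems.ResidualThetaTransportAtTwoCohomologicalPlusPeriodSupplyPeriods
import HarnessLib

/-!
# Crux `ThetaLayerLambdaCongruenceAtTwo` (stmt-BirchSwinnertonDyer-20688): UNCONDITIONAL stabilisation of the `W`-side sup norms
# and the eventual `λ`-growth law `λ_{n+2}(W) = λ_n(W) + 2ⁿ` for the crux's `W`-element

Width seat bsd-wall-rtt-p3-w3 (`--supports stmt-BirchSwinnertonDyer-20688`; closes nothing). THEOREMS ONLY.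

The crux's `W`-side depleted layer element `Θ^{S₀}_n(W) = (θ_n(f)^{alg}·∏_{v∈S₀} E^W_{v,n}) %ₘ ω_n` has coefficients in the image of
`ℚ` in `ℚ̄₂` (`exists_map_eq_wSide`), so its sup norm is `0` or a power `2^m`, `m ∈ ℤ` (`supNorm_map_algebraMap_rat`); it is bounded
uniformly in `n` (Manin: `CohomologicalPeriod.exists_norm_plusSymbolK_eq_max` at the plus period `Ω⁺_f`, integral Euler factors) and
non-decreasing along each parity class (`…TowerGrowth`). A monotone bounded sequence with values in `{0} ∪ 2^ℤ` is eventually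
constant (`eventually_const_of_monotone_of_zpow`). HENCE (`wSide_eventually_stabilized`) the `W`-side sup norms STABILISE along the
even (or odd) layers, unconditionally, and (`wSide_eventual_growth`) if some `Θ^{S₀}_{n₀+2j}(W) ≠ 0` then from some layer `n₁ ≡ n₀`
on, `3λ(Θ_{n₁+2k}(W)) + 2^{n₁} = 3λ(Θ_{n₁}(W)) + 2^{n₁}·4^k` for all `k` — the `W`-side analytic layer law at `p = 2` with NO `μ = 0`
input and no Pollack pair (the constant is fixed by one layer). The `g`-side analogue needs only the discreteness of
`{‖ι y‖ : y ∈ K_g}` (value group of a finite extension of `ℚ₂`), not formalised here.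

Nothing about any curve or form is asserted; BSD is not proved by any of this.

References: [PollackWeston2011MT] Thm. 4.1; [GreenbergVatsal2000] §1–§2; [CremonaAlgorithms1997] §2.3 (Manin's trick).
-/

noncomputable section

-- justification: the `Summit.BirchSwinnertonDyer.BirchSwinnertonDyer.…` path repeats a component (route-file convention)
set_option linter.dupNamespace false

open scoped Classical

open Polynomial

open Literature.NumberTheory.IwasawaTheory Literature.NumberTheory.EllipticCurves
  Literature.NumberTheory.EllipticCurves.ModularForms

namespace Summit.BirchSwinnertonDyer.BirchSwinnertonDyer.Theorems.ThetaLayerLambdaCongruenceAtTwo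

/-! ## §1. A monotone bounded sequence with values in `{0} ∪ 2^ℤ` is eventually constant -/

/-- A non-decreasing sequence of reals, bounded above, all of whose values are `0` or integral powers of `2`, is eventually
constant (its range is finite). [folklore] -/
theorem eventually_const_of_monotone_of_zpow {u : ℕ → ℝ} (hmono : Monotone u) {B : ℝ} (hB : ∀ k, u k ≤ B)
    (hval : ∀ k, u k = 0 ∨ ∃ m : ℤ, u k = (2 : ℝ) ^ m) : ∃ K : ℕ, ∀ k, K ≤ k → u k = u K := by
  classical
  have hfin : (Set.range u).Finite := by
    by_cases hz : ∀ k, u k = 0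
    · exact (Set.finite_singleton (0 : ℝ)).subset (by rintro _ ⟨k, rfl⟩; simp [hz k])
    push Not at hz
    obtain ⟨k₀, hk₀⟩ := hz
    obtain ⟨m₀, hm₀⟩ := (hval k₀).resolve_left hk₀
    obtain ⟨N, hN⟩ := pow_unbounded_of_one_lt B (one_lt_two : (1 : ℝ) < 2)
    refine ((Set.finite_Iio k₀).image u).union
      (((Set.finite_Icc m₀ (N : ℤ)).image fun m : ℤ ↦ (2 : ℝ) ^ m)) |>.subset ?_
    rintro _ ⟨k, rfl⟩
    by_cases hk : k < k₀
    · exact Or.inl ⟨k, hk, rfl⟩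
    · right
      have hge : u k₀ ≤ u k := hmono (not_lt.mp hk)
      have hpos : 0 < u k := by rw [hm₀] at hge; exact lt_of_lt_of_le (zpow_pos two_pos _) hge
      obtain ⟨m, hm⟩ := (hval k).resolve_left hpos.ne'
      refine ⟨m, ⟨?_, ?_⟩, hm.symm⟩
      · rw [hm₀, hm] at hge
        exact (zpow_le_zpow_iff_right₀ (one_lt_two : (1 : ℝ) < 2)).mp hge
      · have h1 : (2 : ℝ) ^ m < (2 : ℝ) ^ (N : ℤ) := by
          rw [← hm, zpow_natCast]; exact (hB k).trans_lt hN
        exact ((zpow_lt_zpow_iff_right₀ (one_lt_two : (1 : ℝ) < 2)).mp h1).le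
  obtain ⟨x, hx, hmax⟩ := hfin.toFinset.exists_max_image id ⟨u 0, by simp⟩
  obtain ⟨K, rfl⟩ : ∃ K, u K = x := by simpa using hx
  refine ⟨K, fun k hk ↦ le_antisymm ?_ (hmono hk)⟩
  exact hmax (u k) (by simp)

/-! ## §2. Sup norms of `ℚ`-rational polynomials read in `ℚ̄₂` -/

/-- The norm of a rational number in `ℚ̄₂` is `0` or an integral power of `2`. [folklore] -/
theorem norm_algebraMap_rat_eq (q : ℚ) :
    ‖algebraMap ℚ (PadicAlgCl 2) q‖ = 0 ∨ ∃ m : ℤ, ‖algebraMap ℚ (PadicAlgCl 2) q‖ = (2 : ℝ) ^ m := by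
  by_cases hq : q = 0
  · left; rw [hq, map_zero, norm_zero]
  right
  refine ⟨-padicValRat 2 q, ?_⟩
  rw [eq_ratCast, ← map_ratCast (algebraMap ℚ_[2] (PadicAlgCl 2)) q]
  rw [PadicAlgCl.norm_extends, Padic.eq_padicNorm, padicNorm.eq_zpow_of_nonzero hq]
  push_cast
  rfl

/-- The sup norm of a `ℚ`-rational polynomial read in `ℚ̄₂` is `0` or an integral power of `2`. [folklore] -/
theorem supNorm_map_algebraMap_rat (R : ℚ[X]) :
    (R.map (algebraMap ℚ (PadicAlgCl 2))).supNorm = 0 ∨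
      ∃ m : ℤ, (R.map (algebraMap ℚ (PadicAlgCl 2))).supNorm = (2 : ℝ) ^ m := by
  obtain ⟨i, hi⟩ := (R.map (algebraMap ℚ (PadicAlgCl 2))).exists_eq_supNorm
  rw [hi, coeff_map]
  exact norm_algebraMap_rat_eq _

/-! ## §3. The `W`-side element is `ℚ`-rational and uniformly bounded -/

section WSide

variable {W : WeierstrassCurve ℚ} [W.IsElliptic] [W.IsGloballyMinimal] [NeZero (W.conductorNorm ℤ)]
  {f : CuspForm (CongruenceSubgroup.Gamma0 (W.conductorNorm ℤ)) 2}
  (S₀ : Finset (IsDedekindDomain.HeightOneSpectrum (NumberField.RingOfIntegers ℚ)))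

/-- `(X+1)^{2^k} − 1` over a field is monic (private helper). [folklore] -/
private theorem monic_X_add_one_pow_two_pow_sub_one_field' (K : Type*) [Field K] (k : ℕ) :
    ((X + 1 : K[X]) ^ 2 ^ k - 1).Monic := by
  have e : (X + 1 : K[X]) = X + C 1 := by rw [C_1]
  have hlt : (1 : K[X]).natDegree < ((X + 1 : K[X]) ^ 2 ^ k).natDegree := by
    rw [e, natDegree_pow, natDegree_X_add_C, mul_one, natDegree_one]; exact pow_pos two_pos _
  exact Monic.sub_of_left (by rw [e]; exact (monic_X_add_C 1).pow _) (degree_lt_degree hlt)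

omit [W.IsElliptic] [W.IsGloballyMinimal] [NeZero (W.conductorNorm ℤ)] in
/-- **The `W`-side depleted layer element is `ℚ`-rational**: it is the image in `ℚ̄₂[X]` of a polynomial over `ℚ`
(the Mazur–Tate element of `f` is in `ℚ[X]`, the Euler factors and `ω_n` have rational coefficients, and `map` commutes
with `%ₘ`). [cite: Pollack2003, Def. 6.15] -/
theorem exists_map_eq_wSide (n : ℕ) :
    ∃ R : ℚ[X], R.map (algebraMap ℚ (PadicAlgCl 2)) = (((Literature.NumberTheory.EllipticCurves.mazurTateElement f 2 n).map (algebraMap ℚ (PadicAlgCl 2)) * ∏ v ∈ S₀, ((W.localPolynomialAt v).map (Int.castRingHom (PadicAlgCl 2))).comp (Polynomial.C ((Rat.HeightOneSpectrum.natGenerator v : PadicAlgCl 2)⁻¹) * (Polynomial.X + 1) ^ (PadicInt.toZModPow n (-(Literature.NumberTheory.EllipticCurves.GreenbergVatsal2000.frobeniusExponent 2 (Rat.HeightOneSpectrum.natGenerator v : ℤ_[2])))).val)) %ₘ ((Polynomial.X + 1) ^ 2 ^ n - 1)) := by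
  refine ⟨(mazurTateElement f 2 n * ∏ v ∈ S₀, ((W.localPolynomialAt v).map (Int.castRingHom ℚ)).comp
    (C ((Rat.HeightOneSpectrum.natGenerator v : ℚ)⁻¹) * (X + 1) ^ (PadicInt.toZModPow n
      (-(Literature.NumberTheory.EllipticCurves.GreenbergVatsal2000.frobeniusExponent 2
        (Rat.HeightOneSpectrum.natGenerator v : ℤ_[2])))).val)) %ₘ ((X + 1) ^ 2 ^ n - 1), ?_⟩
  have hZ : (algebraMap ℚ (PadicAlgCl 2)).comp (Int.castRingHom ℚ) = Int.castRingHom (PadicAlgCl 2) :=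
    RingHom.ext_int _ _
  rw [Polynomial.map_modByMonic _ (monic_X_add_one_pow_two_pow_sub_one_field' ℚ n)]
  simp only [Polynomial.map_mul, Polynomial.map_prod, Polynomial.map_comp, Polynomial.map_pow, Polynomial.map_add,
    Polynomial.map_sub, Polynomial.map_X, Polynomial.map_one, Polynomial.map_C, map_inv₀, map_natCast,
    Polynomial.map_map, hZ]

omit [W.IsElliptic] [W.IsGloballyMinimal] [NeZero (W.conductorNorm ℤ)] in
/-- The `W`-side Euler factor at an odd place has sup norm `≤ 1` (integral coefficients, `ℓ` a `2`-adic unit). [cite: GreenbergVatsal2000, §2 (imprimitive Euler factors; shape)] -/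
theorem supNorm_wEulerFactor_le_one (v : IsDedekindDomain.HeightOneSpectrum (NumberField.RingOfIntegers ℚ))
    (hv : ((2 : ℕ) : NumberField.RingOfIntegers ℚ) ∉ v.asIdeal) (e : ℕ) :
    (((W.localPolynomialAt v).map (Int.castRingHom (PadicAlgCl 2))).comp
      (C ((Rat.HeightOneSpectrum.natGenerator v : PadicAlgCl 2)⁻¹) * (X + 1) ^ e)).supNorm ≤ 1 := by
  refine (supNorm_comp_le ?_ _).trans (supNorm_le_of_forall_coeff_le fun j ↦ ?_)
  · rw [supNorm_C_mul, norm_inv, norm_natCast_padicAlgCl_two_eq_one (not_two_dvd_natGenerator hv), inv_one, one_mul]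
    exact supNorm_pow_le_one supNorm_X_add_one_le e
  · rw [coeff_map, eq_intCast, ← map_intCast (algebraMap ℚ_[2] (PadicAlgCl 2))]
    change ‖((((W.localPolynomialAt v).coeff j : ℤ) : ℚ_[2]) : PadicAlgCl 2)‖ ≤ 1
    rw [PadicAlgCl.norm_extends]
    exact Padic.norm_int_le_one _

omit [NeZero (W.conductorNorm ℤ)] in
/-- **Uniform bound for the `W`-side element**: on the habitat⁺ there is `B` with `‖Θ^{S₀}_n(W)‖_sup ≤ B` for EVERY `n`
(Manin's trick at the plus period `Ω⁺_f`: `CohomologicalPeriod.exists_norm_plusSymbolK_eq_max`; the isometry; integral Euler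
factors; `%ₘ ω_n` non-expanding). [cite: CremonaAlgorithms1997, §2.3 (Manin's trick; shape)] -/
theorem exists_supNorm_wSide_le [NeZero (W.conductorNorm ℤ)]
    (hss : Literature.NumberTheory.EllipticCurves.Rank1Residual.GoodSS W 2) (ha : W.frobeniusTrace 2 = 0)
    (hf : IsNewformOf W f) (hS2 : ∀ v ∈ S₀, ((2 : ℕ) : NumberField.RingOfIntegers ℚ) ∉ v.asIdeal) :
    ∃ B : ℝ, ∀ n : ℕ, ((((Literature.NumberTheory.EllipticCurves.mazurTateElement f 2 n).map (algebraMap ℚ (PadicAlgCl 2)) * ∏ v ∈ S₀, ((W.localPolynomialAt v).map (Int.castRingHom (PadicAlgCl 2))).comp (Polynomial.C ((Rat.HeightOneSpectrum.natGenerator v : PadicAlgCl 2)⁻¹) * (Polynomial.X + 1) ^ (PadicInt.toZModPow n (-(Literature.NumberTheory.EllipticCurves.GreenbergVatsal2000.frobeniusExponent 2 (Rat.HeightOneSpectrum.natGenerator v : ℤ_[2])))).val)) %ₘ ((Polynomial.X + 1) ^ 2 ^ n - 1))).supNorm ≤ B := by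
  obtain ⟨hf0, -, -, hQ, hΩf⟩ := wSide_hyps hss ha hf
  obtain ⟨ιf, hι⟩ := exists_emb_map_mazurTateElement_eq hf0 hQ
  obtain ⟨B, -, hBpos, hBle, -⟩ := CohomologicalPeriod.exists_norm_plusSymbolK_eq_max hf0 ιf hΩf
  refine ⟨‖(2 : PadicAlgCl 2)‖ * B, fun n ↦ ?_⟩
  haveI : NeZero (2 ^ n) := ⟨pow_ne_zero _ two_ne_zero⟩
  refine (supNorm_modByMonic_le (monic_layerModulus (p := 2) n) (supNorm_layerModulus_le_one (p := 2) n) _).trans ?_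
  rw [supNorm_mul', hι n, supNorm_map_mazurTateElementK_two_eq]
  have hE := supNorm_prod_le_one S₀ _ fun v hv ↦ supNorm_wEulerFactor_le_one (W := W) v (hS2 v hv)
    (PadicInt.toZModPow n (-(Literature.NumberTheory.EllipticCurves.GreenbergVatsal2000.frobeniusExponent 2
      (Rat.HeightOneSpectrum.natGenerator v : ℤ_[2])))).val
  have hS : (∑ s : ZMod (2 ^ n), C (ιf (plusSymbolK f (plusPeriod f : ℂ)
      (((((cyclotomicGenerator 2 : ZMod (2 ^ (n + 2))) ^ s.val).val : ℕ) : ℚ) / (2 : ℚ) ^ (n + 2)))) *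
        (X + 1) ^ s.val).supNorm ≤ B :=
    (supNorm_sum_C_mul_X_add_one_pow_le_iff _ hBpos.le).mpr fun t ↦ hBle _
  calc ‖(2 : PadicAlgCl 2)‖ * _ * _ ≤ ‖(2 : PadicAlgCl 2)‖ * B * 1 :=
        mul_le_mul (mul_le_mul_of_nonneg_left hS (norm_nonneg _)) hE (supNorm_nonneg _)
          (mul_nonneg (norm_nonneg _) hBpos.le)
    _ = ‖(2 : PadicAlgCl 2)‖ * B := mul_one _

omit [NeZero (W.conductorNorm ℤ)] in
/-- **`W`-side monotonicity**: `‖Θ^{S₀}_n(W)‖_sup ≤ ‖Θ^{S₀}_{n+2}(W)‖_sup` on the habitat⁺ (generic tower monotonicity for the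
`W`-instance). [cite: PollackWeston2011MT, §4 (shape)] -/
theorem wSide_supNorm_le_add_two [NeZero (W.conductorNorm ℤ)]
    (hss : Literature.NumberTheory.EllipticCurves.Rank1Residual.GoodSS W 2) (ha : W.frobeniusTrace 2 = 0)
    (hf : IsNewformOf W f) (n : ℕ) :
    ((((Literature.NumberTheory.EllipticCurves.mazurTateElement f 2 n).map (algebraMap ℚ (PadicAlgCl 2)) * ∏ v ∈ S₀, ((W.localPolynomialAt v).map (Int.castRingHom (PadicAlgCl 2))).comp (Polynomial.C ((Rat.HeightOneSpectrum.natGenerator v : PadicAlgCl 2)⁻¹) * (Polynomial.X + 1) ^ (PadicInt.toZModPow n (-(Literature.NumberTheory.EllipticCurves.GreenbergVatsal2000.frobeniusExponent 2 (Rat.HeightOneSpectrum.natGenerator v : ℤ_[2])))).val)) %ₘ ((Polynomial.X + 1) ^ 2 ^ n - 1))).supNorm ≤ ((((Literature.NumberTheory.EllipticCurves.mazurTateElement f 2 (n + 2)).map (algebraMap ℚ (PadicAlgCl 2)) * ∏ v ∈ S₀, ((W.localPolynomialAt v).map (Int.castRingHom (PadicAlgCl 2))).comp (Polynomial.C ((Rat.HeightOneSpectrum.natGenerator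 v : PadicAlgCl 2)⁻¹) * (Polynomial.X + 1) ^ (PadicInt.toZModPow (n + 2) (-(Literature.NumberTheory.EllipticCurves.GreenbergVatsal2000.frobeniusExponent 2 (Rat.HeightOneSpectrum.natGenerator v : ℤ_[2])))).val)) %ₘ ((Polynomial.X + 1) ^ 2 ^ (n + 2) - 1))).supNorm := by
  obtain ⟨hf0, h2N, ha2, hQ, hΩf⟩ := wSide_hyps hss ha hf
  obtain ⟨ιf, hι⟩ := exists_emb_map_mazurTateElement_eq hf0 hQ
  simp only [hι]
  exact supNorm_layer_le_add_two_generic ιf (plusPeriod f : ℂ) S₀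
    (fun v ↦ (W.localPolynomialAt v).map (Int.castRingHom (PadicAlgCl 2)))
    (fun v ↦ ((Rat.HeightOneSpectrum.natGenerator v : PadicAlgCl 2)⁻¹))
    (fun v ↦ -(Literature.NumberTheory.EllipticCurves.GreenbergVatsal2000.frobeniusExponent 2
      (Rat.HeightOneSpectrum.natGenerator v : ℤ_[2])))
    hf0 h2N ha2 hΩf n

/-! ## §4. Unconditional stabilisation and the eventual `λ`-growth law on the `W`-side -/

omit [NeZero (W.conductorNorm ℤ)] in
/-- **The `W`-side sup norms are EVENTUALLY CONSTANT along each parity class (unconditionally)**: on the habitat⁺, for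
every `S₀` off `2` and every starting layer `n₀` there is `K` with `‖Θ^{S₀}_{n₀+2k}(W)‖_sup = ‖Θ^{S₀}_{n₀+2K}(W)‖_sup` for all
`k ≥ K` — monotone, bounded, `{0} ∪ 2^ℤ`-valued. [cite: PollackWeston2011MT, §4 (μ-stabilisation; shape)] -/
theorem wSide_supNorm_eventually_const [NeZero (W.conductorNorm ℤ)]
    (hss : Literature.NumberTheory.EllipticCurves.Rank1Residual.GoodSS W 2) (ha : W.frobeniusTrace 2 = 0)
    (hf : IsNewformOf W f) (hS2 : ∀ v ∈ S₀, ((2 : ℕ) : NumberField.RingOfIntegers ℚ) ∉ v.asIdeal) (n₀ : ℕ) :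
    ∃ K : ℕ, ∀ k : ℕ, K ≤ k → ((((Literature.NumberTheory.EllipticCurves.mazurTateElement f 2 (n₀ + 2 * k)).map (algebraMap ℚ (PadicAlgCl 2)) * ∏ v ∈ S₀, ((W.localPolynomialAt v).map (Int.castRingHom (PadicAlgCl 2))).comp (Polynomial.C ((Rat.HeightOneSpectrum.natGenerator v : PadicAlgCl 2)⁻¹) * (Polynomial.X + 1) ^ (PadicInt.toZModPow (n₀ + 2 * k) (-(Literature.NumberTheory.EllipticCurves.GreenbergVatsal2000.frobeniusExponent 2 (Rat.HeightOneSpectrum.natGenerator v : ℤ_[2])))).val)) %ₘ ((Polynomial.X + 1) ^ 2 ^ (n₀ + 2 * k) - 1))).supNorm = ((((Literature.NumberTheory.EllipticCurves.mazurTateElement f 2 (n₀ + 2 * K)).map (algebraMap ℚ (PadicAlgCl 2)) * ∏ v ∈ S₀, ((W.localPolynomialAt v).map (Int.castRingHom (PadicAlgCl 2))).comp (Polynomial.C ((Rat.HeightOneSpectrum.natGenerator v : PadicAlgCl 2)⁻¹) * (Polynomial.X + 1) ^ (PadicInt.toZModPow (n₀ + 2 * K) (-(Literature.NumberTheory.EllipticCurves.GreenbergVatsal2000.frobeniusExponent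 2 (Rat.HeightOneSpectrum.natGenerator v : ℤ_[2])))).val)) %ₘ ((Polynomial.X + 1) ^ 2 ^ (n₀ + 2 * K) - 1))).supNorm := by
  set u : ℕ → ℝ := fun k ↦ ((((Literature.NumberTheory.EllipticCurves.mazurTateElement f 2 (n₀ + 2 * k)).map (algebraMap ℚ (PadicAlgCl 2)) * ∏ v ∈ S₀, ((W.localPolynomialAt v).map (Int.castRingHom (PadicAlgCl 2))).comp (Polynomial.C ((Rat.HeightOneSpectrum.natGenerator v : PadicAlgCl 2)⁻¹) * (Polynomial.X + 1) ^ (PadicInt.toZModPow (n₀ + 2 * k) (-(Literature.NumberTheory.EllipticCurves.GreenbergVatsal2000.frobeniusExponent 2 (Rat.HeightOneSpectrum.natGenerator v : ℤ_[2])))).val)) %ₘ ((Polynomial.X + 1) ^ 2 ^ (n₀ + 2 * k) - 1))).supNorm with hu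
  have hmono : Monotone u := by
    refine monotone_nat_of_le_succ fun k ↦ ?_
    simp only [hu]
    exact wSide_supNorm_le_add_two S₀ hss ha hf (n₀ + 2 * k)
  obtain ⟨B, hB⟩ := exists_supNorm_wSide_le S₀ hss ha hf hS2
  have hval : ∀ k, u k = 0 ∨ ∃ m : ℤ, u k = (2 : ℝ) ^ m := by
    intro k
    obtain ⟨R, hR⟩ := exists_map_eq_wSide (W := W) (f := f) S₀ (n₀ + 2 * k)
    simp only [hu]
    rw [← hR]
    exact supNorm_map_algebraMap_rat R
  exact eventually_const_of_monotone_of_zpow hmono (fun k ↦ hB _) hval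

omit [NeZero (W.conductorNorm ℤ)] in
/-- **The `W`-side sup norms STABILISE (unconditionally)**: with `K` as above and `n₁ = n₀ + 2K`,
`‖Θ^{S₀}_{n₁+2k+2}(W)‖_sup ≤ ‖Θ^{S₀}_{n₁+2k}(W)‖_sup` for all `k` (the hypothesis of `wSide_growth_mul_of_stabilized`).
[cite: PollackWeston2011MT, §4 (μ-stabilisation; shape)] -/
theorem wSide_eventually_stabilized [NeZero (W.conductorNorm ℤ)]
    (hss : Literature.NumberTheory.EllipticCurves.Rank1Residual.GoodSS W 2) (ha : W.frobeniusTrace 2 = 0)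
    (hf : IsNewformOf W f) (hS2 : ∀ v ∈ S₀, ((2 : ℕ) : NumberField.RingOfIntegers ℚ) ∉ v.asIdeal) (n₀ : ℕ) :
    ∃ j₀ : ℕ, ∀ k : ℕ, ((((Literature.NumberTheory.EllipticCurves.mazurTateElement f 2 (n₀ + 2 * j₀ + 2 * k + 2)).map (algebraMap ℚ (PadicAlgCl 2)) * ∏ v ∈ S₀, ((W.localPolynomialAt v).map (Int.castRingHom (PadicAlgCl 2))).comp (Polynomial.C ((Rat.HeightOneSpectrum.natGenerator v : PadicAlgCl 2)⁻¹) * (Polynomial.X + 1) ^ (PadicInt.toZModPow (n₀ + 2 * j₀ + 2 * k + 2) (-(Literature.NumberTheory.EllipticCurves.GreenbergVatsal2000.frobeniusExponent 2 (Rat.HeightOneSpectrum.natGenerator v : ℤ_[2])))).val)) %ₘ ((Polynomial.X + 1) ^ 2 ^ (n₀ + 2 * j₀ + 2 * k + 2) - 1))).supNorm ≤ ((((Literature.NumberTheory.EllipticCurves.mazurTateElement f 2 (n₀ + 2 * j₀ + 2 * k)).map (algebraMap ℚ (PadicAlgCl 2)) * ∏ v ∈ S₀, ((W.localPolynomialAt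 v).map (Int.castRingHom (PadicAlgCl 2))).comp (Polynomial.C ((Rat.HeightOneSpectrum.natGenerator v : PadicAlgCl 2)⁻¹) * (Polynomial.X + 1) ^ (PadicInt.toZModPow (n₀ + 2 * j₀ + 2 * k) (-(Literature.NumberTheory.EllipticCurves.GreenbergVatsal2000.frobeniusExponent 2 (Rat.HeightOneSpectrum.natGenerator v : ℤ_[2])))).val)) %ₘ ((Polynomial.X + 1) ^ 2 ^ (n₀ + 2 * j₀ + 2 * k) - 1))).supNorm := by
  obtain ⟨K, hK⟩ := wSide_supNorm_eventually_const S₀ hss ha hf hS2 n₀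
  refine ⟨K, fun k ↦ ?_⟩
  have h1 := hK (K + k + 1) (by omega)
  have h2 := hK (K + k) (by omega)
  have e1 : n₀ + 2 * K + 2 * k + 2 = n₀ + 2 * (K + k + 1) := by ring
  have e2 : n₀ + 2 * K + 2 * k = n₀ + 2 * (K + k) := by ring
  change (fun m : ℕ ↦ ((((Literature.NumberTheory.EllipticCurves.mazurTateElement f 2 m).map (algebraMap ℚ (PadicAlgCl 2)) * ∏ v ∈ S₀, ((W.localPolynomialAt v).map (Int.castRingHom (PadicAlgCl 2))).comp (Polynomial.C ((Rat.HeightOneSpectrum.natGenerator v : PadicAlgCl 2)⁻¹) * (Polynomial.X + 1) ^ (PadicInt.toZModPow m (-(Literature.NumberTheory.EllipticCurves.GreenbergVatsal2000.frobeniusExponent 2 (Rat.HeightOneSpectrum.natGenerator v : ℤ_[2])))).val)) %ₘ ((Polynomial.X + 1) ^ 2 ^ m - 1))).supNorm) (n₀ + 2 * K + 2 * k + 2) ≤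
    (fun m : ℕ ↦ ((((Literature.NumberTheory.EllipticCurves.mazurTateElement f 2 m).map (algebraMap ℚ (PadicAlgCl 2)) * ∏ v ∈ S₀, ((W.localPolynomialAt v).map (Int.castRingHom (PadicAlgCl 2))).comp (Polynomial.C ((Rat.HeightOneSpectrum.natGenerator v : PadicAlgCl 2)⁻¹) * (Polynomial.X + 1) ^ (PadicInt.toZModPow m (-(Literature.NumberTheory.EllipticCurves.GreenbergVatsal2000.frobeniusExponent 2 (Rat.HeightOneSpectrum.natGenerator v : ℤ_[2])))).val)) %ₘ ((Polynomial.X + 1) ^ 2 ^ m - 1))).supNorm) (n₀ + 2 * K + 2 * k)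
  rw [e1, e2]
  exact (h1.trans h2.symm).le

omit [NeZero (W.conductorNorm ℤ)] in
/-- **THE `W`-SIDE ANALYTIC LAYER LAW AT `p = 2`, UNCONDITIONALLY** (no `μ = 0`, no Pollack/Sprung pair): on the habitat⁺, for the
newform `f` of `W`, every admissible `S₀` off `2` and every parity class `n₀ + 2ℕ` containing a non-zero depleted element, there is
a layer `n₁ = n₀ + 2j₀` with `Θ^{S₀}_{n₁}(W) ≠ 0` and `3λ(Θ^{S₀}_{n₁+2k}(W)) + 2^{n₁} = 3λ(Θ^{S₀}_{n₁}(W)) + 2^{n₁}·4^k` for ALL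
`k`, i.e. `λ_{n₁+2k}(W) = λ_{n₁}(W) + 2^{n₁}(4^k − 1)/3` (stabilisation + three-term relation). [cite: PollackWeston2011MT, Thm. 4.1 (λ(θ_n) = q_n + λ; read at 2, W-side)] -/
theorem wSide_eventual_growth [NeZero (W.conductorNorm ℤ)]
    (hss : Literature.NumberTheory.EllipticCurves.Rank1Residual.GoodSS W 2) (ha : W.frobeniusTrace 2 = 0)
    (hf : IsNewformOf W f) (hS2 : ∀ v ∈ S₀, ((2 : ℕ) : NumberField.RingOfIntegers ℚ) ∉ v.asIdeal) (n₀ : ℕ)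
    (hne : ∃ j : ℕ, (((Literature.NumberTheory.EllipticCurves.mazurTateElement f 2 (n₀ + 2 * j)).map (algebraMap ℚ (PadicAlgCl 2)) * ∏ v ∈ S₀, ((W.localPolynomialAt v).map (Int.castRingHom (PadicAlgCl 2))).comp (Polynomial.C ((Rat.HeightOneSpectrum.natGenerator v : PadicAlgCl 2)⁻¹) * (Polynomial.X + 1) ^ (PadicInt.toZModPow (n₀ + 2 * j) (-(Literature.NumberTheory.EllipticCurves.GreenbergVatsal2000.frobeniusExponent 2 (Rat.HeightOneSpectrum.natGenerator v : ℤ_[2])))).val)) %ₘ ((Polynomial.X + 1) ^ 2 ^ (n₀ + 2 * j) - 1)) ≠ 0) :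
    ∃ j₀ : ℕ, (((Literature.NumberTheory.EllipticCurves.mazurTateElement f 2 (n₀ + 2 * j₀)).map (algebraMap ℚ (PadicAlgCl 2)) * ∏ v ∈ S₀, ((W.localPolynomialAt v).map (Int.castRingHom (PadicAlgCl 2))).comp (Polynomial.C ((Rat.HeightOneSpectrum.natGenerator v : PadicAlgCl 2)⁻¹) * (Polynomial.X + 1) ^ (PadicInt.toZModPow (n₀ + 2 * j₀) (-(Literature.NumberTheory.EllipticCurves.GreenbergVatsal2000.frobeniusExponent 2 (Rat.HeightOneSpectrum.natGenerator v : ℤ_[2])))).val)) %ₘ ((Polynomial.X + 1) ^ 2 ^ (n₀ + 2 * j₀) - 1)) ≠ 0 ∧ ∀ k : ℕ,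
      3 * layerLambda (((Literature.NumberTheory.EllipticCurves.mazurTateElement f 2 (n₀ + 2 * j₀ + 2 * k)).map (algebraMap ℚ (PadicAlgCl 2)) * ∏ v ∈ S₀, ((W.localPolynomialAt v).map (Int.castRingHom (PadicAlgCl 2))).comp (Polynomial.C ((Rat.HeightOneSpectrum.natGenerator v : PadicAlgCl 2)⁻¹) * (Polynomial.X + 1) ^ (PadicInt.toZModPow (n₀ + 2 * j₀ + 2 * k) (-(Literature.NumberTheory.EllipticCurves.GreenbergVatsal2000.frobeniusExponent 2 (Rat.HeightOneSpectrum.natGenerator v : ℤ_[2])))).val)) %ₘ ((Polynomial.X + 1) ^ 2 ^ (n₀ + 2 * j₀ + 2 * k) - 1)) + 2 ^ (n₀ + 2 * j₀) = 3 * layerLambda (((Literature.NumberTheory.EllipticCurves.mazurTateElement f 2 (n₀ + 2 * j₀)).map (algebraMap ℚ (PadicAlgCl 2)) * ∏ v ∈ S₀, ((W.localPolynomialAt v).map (Int.castRingHom (PadicAlgCl 2))).comp (Polynomial.C ((Rat.HeightOneSpectrum.natGenerator v : PadicAlgCl 2)⁻¹) * (Polynomial.X + 1) ^ (PadicInt.toZModPow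 (n₀ + 2 * j₀) (-(Literature.NumberTheory.EllipticCurves.GreenbergVatsal2000.frobeniusExponent 2 (Rat.HeightOneSpectrum.natGenerator v : ℤ_[2])))).val)) %ₘ ((Polynomial.X + 1) ^ 2 ^ (n₀ + 2 * j₀) - 1)) + 2 ^ (n₀ + 2 * j₀) * 4 ^ k := by
  obtain ⟨K, hK⟩ := wSide_supNorm_eventually_const S₀ hss ha hf hS2 n₀
  set u : ℕ → ℝ := fun k ↦ ((((Literature.NumberTheory.EllipticCurves.mazurTateElement f 2 (n₀ + 2 * k)).map (algebraMap ℚ (PadicAlgCl 2)) * ∏ v ∈ S₀, ((W.localPolynomialAt v).map (Int.castRingHom (PadicAlgCl 2))).comp (Polynomial.C ((Rat.HeightOneSpectrum.natGenerator v : PadicAlgCl 2)⁻¹) * (Polynomial.X + 1) ^ (PadicInt.toZModPow (n₀ + 2 * k) (-(Literature.NumberTheory.EllipticCurves.GreenbergVatsal2000.frobeniusExponent 2 (Rat.HeightOneSpectrum.natGenerator v : ℤ_[2])))).val)) %ₘ ((Polynomial.X + 1) ^ 2 ^ (n₀ + 2 * k) - 1))).supNorm with hu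
  have hmono : Monotone u := by
    refine monotone_nat_of_le_succ fun k ↦ ?_
    simp only [hu]
    exact wSide_supNorm_le_add_two S₀ hss ha hf (n₀ + 2 * k)
  -- non-vanishing at the stabilised layer `n₀ + 2K`
  obtain ⟨j, hj⟩ := hne
  have hjpos : 0 < u j := lt_of_le_of_ne (supNorm_nonneg _) (Ne.symm ((supNorm_eq_zero_iff _).not.mpr hj))
  have hKpos : 0 < u K := by
    have h1 : u j ≤ u (max K j) := hmono (le_max_right _ _)
    have h2 : u (max K j) = u K := hK _ (le_max_left _ _)
    linarith
  have h0 : (((Literature.NumberTheory.EllipticCurves.mazurTateElement f 2 (n₀ + 2 * K)).map (algebraMap ℚ (PadicAlgCl 2)) * ∏ v ∈ S₀, ((W.localPolynomialAt v).map (Int.castRingHom (PadicAlgCl 2))).comp (Polynomial.C ((Rat.HeightOneSpectrum.natGenerator v : PadicAlgCl 2)⁻¹) * (Polynomial.X + 1) ^ (PadicInt.toZModPow (n₀ + 2 * K) (-(Literature.NumberTheory.EllipticCurves.GreenbergVatsal2000.frobeniusExponent 2 (Rat.HeightOneSpectrum.natGenerator v : ℤ_[2])))).val)) %ₘ ((Polynomial.X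 + 1) ^ 2 ^ (n₀ + 2 * K) - 1)) ≠ 0 := fun hz ↦ by
    have : u K = 0 := by simp only [hu]; rw [hz, supNorm_zero]
    exact hKpos.ne' this
  -- stabilisation from the layer `n₀ + 2K`
  have hst' : ∀ k : ℕ, ((((Literature.NumberTheory.EllipticCurves.mazurTateElement f 2 (n₀ + 2 * K + 2 * k + 2)).map (algebraMap ℚ (PadicAlgCl 2)) * ∏ v ∈ S₀, ((W.localPolynomialAt v).map (Int.castRingHom (PadicAlgCl 2))).comp (Polynomial.C ((Rat.HeightOneSpectrum.natGenerator v : PadicAlgCl 2)⁻¹) * (Polynomial.X + 1) ^ (PadicInt.toZModPow (n₀ + 2 * K + 2 * k + 2) (-(Literature.NumberTheory.EllipticCurves.GreenbergVatsal2000.frobeniusExponent 2 (Rat.HeightOneSpectrum.natGenerator v : ℤ_[2])))).val)) %ₘ ((Polynomial.X + 1) ^ 2 ^ (n₀ + 2 * K + 2 * k + 2) - 1))).supNorm ≤ ((((Literature.NumberTheory.EllipticCurves.mazurTateElement f 2 (n₀ + 2 * K + 2 * k)).map (algebraMap ℚ (PadicAlgCl 2)) * ∏ v ∈ S₀, ((W.localPolynomialAt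 v).map (Int.castRingHom (PadicAlgCl 2))).comp (Polynomial.C ((Rat.HeightOneSpectrum.natGenerator v : PadicAlgCl 2)⁻¹) * (Polynomial.X + 1) ^ (PadicInt.toZModPow (n₀ + 2 * K + 2 * k) (-(Literature.NumberTheory.EllipticCurves.GreenbergVatsal2000.frobeniusExponent 2 (Rat.HeightOneSpectrum.natGenerator v : ℤ_[2])))).val)) %ₘ ((Polynomial.X + 1) ^ 2 ^ (n₀ + 2 * K + 2 * k) - 1))).supNorm := by
    intro k
    have h1 := hK (K + k + 1) (by omega)
    have h2 := hK (K + k) (by omega)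
    have e1 : n₀ + 2 * K + 2 * k + 2 = n₀ + 2 * (K + k + 1) := by ring
    have e2 : n₀ + 2 * K + 2 * k = n₀ + 2 * (K + k) := by ring
    change (fun m : ℕ ↦ ((((Literature.NumberTheory.EllipticCurves.mazurTateElement f 2 m).map (algebraMap ℚ (PadicAlgCl 2)) * ∏ v ∈ S₀, ((W.localPolynomialAt v).map (Int.castRingHom (PadicAlgCl 2))).comp (Polynomial.C ((Rat.HeightOneSpectrum.natGenerator v : PadicAlgCl 2)⁻¹) * (Polynomial.X + 1) ^ (PadicInt.toZModPow m (-(Literature.NumberTheory.EllipticCurves.GreenbergVatsal2000.frobeniusExponent 2 (Rat.HeightOneSpectrum.natGenerator v : ℤ_[2])))).val)) %ₘ ((Polynomial.X + 1) ^ 2 ^ m - 1))).supNorm) (n₀ + 2 * K + 2 * k + 2) ≤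
      (fun m : ℕ ↦ ((((Literature.NumberTheory.EllipticCurves.mazurTateElement f 2 m).map (algebraMap ℚ (PadicAlgCl 2)) * ∏ v ∈ S₀, ((W.localPolynomialAt v).map (Int.castRingHom (PadicAlgCl 2))).comp (Polynomial.C ((Rat.HeightOneSpectrum.natGenerator v : PadicAlgCl 2)⁻¹) * (Polynomial.X + 1) ^ (PadicInt.toZModPow m (-(Literature.NumberTheory.EllipticCurves.GreenbergVatsal2000.frobeniusExponent 2 (Rat.HeightOneSpectrum.natGenerator v : ℤ_[2])))).val)) %ₘ ((Polynomial.X + 1) ^ 2 ^ m - 1))).supNorm) (n₀ + 2 * K + 2 * k)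
    rw [e1, e2]
    exact (h1.trans h2.symm).le
  exact ⟨K, h0, fun k ↦ wSide_growth_mul_of_stabilized S₀ hss ha hf h0 hst' k⟩

end WSide

end Summit.BirchSwinnertonDyer.BirchSwinnertonDyer.Theorems.ThetaLayerLambdaCongruenceAtTwo

end
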